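import Mathlib
import HarnessLib
import Literature.MathematicalPhysics.QuantumFieldTheory.ConstructiveQFTWave0
import Summits.Ventures.LatticeQCDFlow.Scaling.PlaquetteIndependence2D
import Summits.Ventures.LatticeQCDFlow.Scaling.WilsonPairCovarianceTwoDim
import Summits.Ventures.LatticeQCDFlow.Scaling.PlaquettePatchDecorrelationTwoDim

/-!
# LatticeQCDFlow / Scaling — the two-dimensional Wilson partition function is `m(w)^{L²}` to exponential accuracy, every compact gauge group

HONEST FRAMING: exact (Metropolis-corrected) sampling algorithms for lattice gauge theory; figures of merit are
autocorrelation/cost numbers at stated couplings and volumes; no continuum-physics claim.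

Venture `LatticeQCDFlow` (cell pub-lqcd), topic `Scaling`, FANOUT row 30 (lean-1) — OUR WORK, a corollary of the empty-patch
case of the one-bad-set expansion (`Scaling/PlaquettePatchDecorrelationTwoDim.lintegral_prod_weight_two_sandwich`: for any
weight `w = c + v`, `v ≤ s`, on `(ℤ/L)²`, `(c+y)^{L²} ≤ Z + y^{L²}` and `Z ≤ (c+y)^{L²} + s·y^{L²−1}`, `y = m(v)`) for the
Wilson weight `w(g) = e^{−β(N − Re tr ρ(g))}` of a CONTINUOUS representation `ρ` of a compact second-countable `G` at ANY
real `β` (`Scaling/WilsonPairCovarianceTwoDim.wilson_oneWeight_bounds`):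

* **`wilson_partitionFunction_two_asymptotics`** — there are `z > 0` (`= ∫ e^{−β(N − Re tr ρ)} dHaar`, the one-plaquette
  integral), `0 ≤ q < 1` and `C ≥ 0` with `|Z_{(ℤ/L)²}(β)/z^{L²} − 1| ≤ C·q^{L²−1}` for every `L ≥ 2`: the torus free
  energy is `L²·log z + O(q^{L²})`, sharpening the `O(1)` (one-plaquette) slack of the tree's
  `PlaquetteIndependence2D.partitionFunction_two_le` / `le_partitionFunction_two` and
  `TorusFreeEnergyDensity2D.log_partitionFunction_two_mem` (row 5), and with no sign condition on `β`;
* `wilson_log_partitionFunction_two` — `|log Z_{(ℤ/L)²}(β) − L²·log z| ≤ 2C·q^{L²−1}` as soon as `C·q^{L²−1} ≤ 1/2`.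

(`G : Type`.)  Literature grade: known (two-dimensional lattice gauge theory is solvable; the exact character formula
`Z = Σ_λ d_λ^{2−2g} ĉ_λ^{L²}` gives the same with `q = max_{λ≠0} |ĉ_λ/ĉ_0|`; Migdal 1975, Gross–Witten 1980); new =
character-free and kernel-checked for every compact group.  Elementary given the tree; nothing here is cited as a fact;
no `def`, no `sorry`.
-/

noncomputable section

namespace Summit.Ventures.LatticeQCDFlow.Theory2.Lattice.TwoDim

open MeasureTheory Filter Topology Literature.MathematicalPhysics.QuantumFieldTheory
open scoped ENNReal

/-! ## The Wilson partition function of `(ℤ/L)²` to exponential accuracy, every compact `G` -/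

section Wilson

variable {N : ℕ} {H : Type} [Group H] [TopologicalSpace H] [IsTopologicalGroup H] [CompactSpace H]
  [SecondCountableTopology H] [MeasurableSpace H] [BorelSpace H] (ρ : H →* Matrix (Fin N) (Fin N) ℂ)

/-- **THE TWO-DIMENSIONAL WILSON PARTITION FUNCTION IS `m(w)^{L²}` UP TO A RELATIVE ERROR EXPONENTIALLY SMALL IN THE
VOLUME**, for every compact second-countable gauge group, every continuous representation and every real coupling:
there are `z > 0` (`= ∫ e^{−β(N − Re tr ρ)} dHaar`), `0 ≤ q < 1` and `C ≥ 0` with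
`|Z_{(ℤ/L)²}(β)/z^{L²} − 1| ≤ C·q^{L²−1}` for every `L ≥ 2` — the free energy is `L²·log z + O(q^{L²})`, sharpening the
tree's `TorusFreeEnergyDensity2D.log_partitionFunction_two_mem` (`O(1)` slack). [folklore] -/
theorem wilson_partitionFunction_two_asymptotics (hρ : Continuous ρ) (β : ℝ) :
    ∃ z q C : ℝ, 0 < z ∧ 0 ≤ q ∧ q < 1 ∧ 0 ≤ C ∧
      ∀ (L : ℕ) [NeZero L], 2 ≤ L →
        |(partitionFunction (d := 2) (L := L) ρ β).toReal / z ^ (L ^ 2) - 1| ≤ C * q ^ (L ^ 2 - 1) := by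
  classical
  obtain ⟨M, hM0, hM⟩ := wilson_oneWeight_bounds ρ hρ β
  set K : ℝ := |β| * ((N : ℝ) + M) with hK
  set cr : ℝ := Real.exp (-K) with hcr
  set sr : ℝ := Real.exp K with hsr
  have hcr0 : 0 < cr := Real.exp_pos _
  have hsr0 : 0 < sr := Real.exp_pos _
  set w : H → ℝ≥0∞ := fun g => ENNReal.ofReal (Real.exp (-(β * ((N : ℝ) - (ρ g).trace.re)))) with hw
  set c : ℝ≥0∞ := ENNReal.ofReal cr with hc
  set sE : ℝ≥0∞ := ENNReal.ofReal sr with hsE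
  have hwm : Measurable w := measurable_oneWeight ρ hρ β
  have hcw : ∀ g, c ≤ w g := fun g => ENNReal.ofReal_le_ofReal (hM g).1
  have hws : ∀ g, w g ≤ sE := fun g => ENNReal.ofReal_le_ofReal (hM g).2
  set v : H → ℝ≥0∞ := fun g => w g - c with hv
  have hvm : Measurable v := hwm.sub measurable_const
  have hcv : ∀ g, c + v g = w g := fun g => add_tsub_cancel_of_le (hcw g)
  have hvs : ∀ g, v g ≤ sE := fun g => tsub_le_self.trans (hws g)
  have hct : c ≠ ⊤ := ENNReal.ofReal_ne_top
  have hsEt : sE ≠ ⊤ := ENNReal.ofReal_ne_top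
  set y : ℝ≥0∞ := ∫⁻ g, v g ∂(haarProbability H) with hy
  have hyle : y ≤ sE := by
    calc y ≤ ∫⁻ _, sE ∂(haarProbability H) := lintegral_mono fun g => hvs g
      _ = sE := by rw [lintegral_const, measure_univ, mul_one]
  have hyt : y ≠ ⊤ := ne_top_of_le_ne_top hsEt hyle
  set yr : ℝ := y.toReal with hyr
  have hyr0 : 0 ≤ yr := ENNReal.toReal_nonneg
  set zr : ℝ := cr + yr with hzr
  have hzr0 : 0 < zr := by linarith
  have hyz : yr < zr := by linarith
  have hcyr : (c + y).toReal = zr := by rw [ENNReal.toReal_add hct hyt, hc, ENNReal.toReal_ofReal hcr0.le]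
  have hsEr : sE.toReal = sr := ENNReal.toReal_ofReal hsr0.le
  have hcyt : c + y ≠ ⊤ := ENNReal.add_ne_top.mpr ⟨hct, hyt⟩
  set q : ℝ := yr / zr with hq
  have hq0 : 0 ≤ q := div_nonneg hyr0 hzr0.le
  have hq1 : q < 1 := (div_lt_one hzr0).mpr hyz
  refine ⟨zr, q, max (sr / zr) 1, hzr0, hq0, hq1, le_max_of_le_right zero_le_one, fun L _ hL => ?_⟩
  -- the partition function in product form
  have hdensprod : ∀ U : GaugeConfig 2 L H, ENNReal.ofReal (Real.exp (-β * wilsonAction ρ U)) =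
      ∏ x, (c + v (plaquetteHolonomy U x 0 1)) := fun U => by
    rw [weight_eq_prod_two ρ β U]
    exact Finset.prod_congr rfl fun x _ => (hcv _).symm
  have hZ : partitionFunction (d := 2) (L := L) ρ β =
      ∫⁻ U, ∏ x, (c + v (plaquetteHolonomy U x 0 1)) ∂(Measure.pi fun _ : Edge 2 L => haarProbability H) := by
    unfold partitionFunction wilsonWeight
    rw [withDensity_apply _ MeasurableSet.univ, Measure.restrict_univ]
    exact lintegral_congr fun U => hdensprod U
  obtain ⟨hLo, hU⟩ := lintegral_prod_weight_two_sandwich (L := L) hL c hvm hvs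
  rw [← hZ] at hLo hU
  set Z := partitionFunction (d := 2) (L := L) ρ β with hZdef
  -- to real numbers
  have hUt : (c + y) ^ (L ^ 2) + sE * y ^ (L ^ 2 - 1) ≠ ⊤ :=
    ENNReal.add_ne_top.mpr ⟨ENNReal.pow_ne_top hcyt, ENNReal.mul_ne_top hsEt (ENNReal.pow_ne_top hyt)⟩
  have hZt : Z ≠ ⊤ := ne_top_of_le_ne_top hUt hU
  set Zr := Z.toReal with hZr
  have hZr_le : Zr ≤ zr ^ (L ^ 2) + sr * yr ^ (L ^ 2 - 1) := by
    have h := ENNReal.toReal_mono hUt hU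
    rwa [ENNReal.toReal_add (ENNReal.pow_ne_top hcyt) (ENNReal.mul_ne_top hsEt (ENNReal.pow_ne_top hyt)),
      ENNReal.toReal_pow, ENNReal.toReal_mul, ENNReal.toReal_pow, hcyr, hsEr] at h
  have hZr_ge : zr ^ (L ^ 2) ≤ Zr + yr ^ (L ^ 2) := by
    have h := ENNReal.toReal_mono (ENNReal.add_ne_top.mpr ⟨hZt, ENNReal.pow_ne_top hyt⟩) hLo
    rwa [ENNReal.toReal_add hZt (ENNReal.pow_ne_top hyt), ENNReal.toReal_pow, ENNReal.toReal_pow, hcyr] at h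
  -- the relative error
  have h1L : 1 ≤ L ^ 2 := by nlinarith
  have hzpow : (0 : ℝ) < zr ^ (L ^ 2) := pow_pos hzr0 _
  have hzsplit : zr ^ (L ^ 2) = zr ^ (L ^ 2 - 1) * zr := by
    rw [← pow_succ, Nat.sub_add_cancel h1L]
  have hyq : yr = q * zr := by rw [hq]; field_simp
  have hypow : ∀ n : ℕ, yr ^ n = q ^ n * zr ^ n := fun n => by rw [hyq, mul_pow]
  have hupper : Zr / zr ^ (L ^ 2) - 1 ≤ (sr / zr) * q ^ (L ^ 2 - 1) := by
    rw [div_sub_one hzpow.ne', div_le_iff₀ hzpow]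
    have h1 : Zr - zr ^ (L ^ 2) ≤ sr * yr ^ (L ^ 2 - 1) := by linarith
    have h2 : sr * yr ^ (L ^ 2 - 1) = sr / zr * q ^ (L ^ 2 - 1) * zr ^ (L ^ 2) := by
      rw [hypow, hzsplit, div_mul_eq_mul_div, div_mul_eq_mul_div, eq_div_iff hzr0.ne']
      ring
    linarith
  have hlower : -(q ^ (L ^ 2 - 1)) ≤ Zr / zr ^ (L ^ 2) - 1 := by
    rw [div_sub_one hzpow.ne', le_div_iff₀ hzpow]
    have h1 : -(yr ^ (L ^ 2)) ≤ Zr - zr ^ (L ^ 2) := by linarith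
    have h2 : yr ^ (L ^ 2) ≤ q ^ (L ^ 2 - 1) * zr ^ (L ^ 2) := by
      rw [hypow]
      exact mul_le_mul_of_nonneg_right (pow_le_pow_of_le_one hq0 hq1.le (Nat.sub_le _ _)) hzpow.le
    linarith
  rw [abs_le]
  constructor
  · have : q ^ (L ^ 2 - 1) ≤ max (sr / zr) 1 * q ^ (L ^ 2 - 1) :=
      le_mul_of_one_le_left (pow_nonneg hq0 _) (le_max_right _ _)
    linarith
  · exact hupper.trans (mul_le_mul_of_nonneg_right (le_max_left _ _) (pow_nonneg hq0 _))

/-- **THE TWO-DIMENSIONAL FREE ENERGY IS `L²·log z` UP TO AN EXPONENTIALLY SMALL ERROR**: with `z, q, C` as in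
`wilson_partitionFunction_two_asymptotics`, for every `L ≥ 2` with `C·q^{L²−1} ≤ 1/2`:
`|log Z_{(ℤ/L)²}(β) − L²·log z| ≤ 2C·q^{L²−1}`. [folklore] -/
theorem wilson_log_partitionFunction_two (hρ : Continuous ρ) (β : ℝ) :
    ∃ z q C : ℝ, 0 < z ∧ 0 ≤ q ∧ q < 1 ∧ 0 ≤ C ∧
      ∀ (L : ℕ) [NeZero L], 2 ≤ L → C * q ^ (L ^ 2 - 1) ≤ 1 / 2 →
        |Real.log (partitionFunction (d := 2) (L := L) ρ β).toReal - (L : ℝ) ^ 2 * Real.log z| ≤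
          2 * (C * q ^ (L ^ 2 - 1)) := by
  obtain ⟨z, q, C, hz, hq0, hq1, hC, h⟩ := wilson_partitionFunction_two_asymptotics ρ hρ β
  refine ⟨z, q, C, hz, hq0, hq1, hC, fun L _ hL hsmall => ?_⟩
  have hb := h L hL
  set ε : ℝ := C * q ^ (L ^ 2 - 1) with hε
  set x : ℝ := (partitionFunction (d := 2) (L := L) ρ β).toReal / z ^ (L ^ 2) with hx
  have hzA : 0 < z ^ (L ^ 2) := pow_pos hz _
  obtain ⟨hlo, hhi⟩ := abs_le.mp hb
  have hx0 : 0 < x := by linarith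
  have hZeq : (partitionFunction (d := 2) (L := L) ρ β).toReal = x * z ^ (L ^ 2) := by
    rw [hx, div_mul_cancel₀ _ hzA.ne']
  have hlog : Real.log (partitionFunction (d := 2) (L := L) ρ β).toReal - (L : ℝ) ^ 2 * Real.log z = Real.log x := by
    rw [hZeq, Real.log_mul hx0.ne' hzA.ne', Real.log_pow]
    push_cast
    ring
  rw [hlog, abs_le]
  have hε0 : 0 ≤ ε := mul_nonneg hC (pow_nonneg hq0 _)
  constructor
  · -- `log x ≥ 1 − 1/x ≥ 1 − 1/(1 − ε) ≥ −2ε`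
    have h1 : 1 - x⁻¹ ≤ Real.log x := by
      have := Real.add_one_le_exp (Real.log x⁻¹)
      have h2 : Real.log x⁻¹ = -Real.log x := Real.log_inv x
      rw [Real.exp_log (inv_pos.mpr hx0), h2] at this
      linarith
    have h1e : 0 < 1 - ε := by linarith
    have hxge : 1 - ε ≤ x := by linarith
    have hinv1 : x⁻¹ ≤ (1 - ε)⁻¹ := inv_anti₀ h1e hxge
    have hinv2 : (1 - ε)⁻¹ ≤ 1 + 2 * ε := by
      rw [inv_eq_one_div, div_le_iff₀ h1e]; nlinarith
    linarith
  · -- `log x ≤ x − 1 ≤ ε ≤ 2ε`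
    have h1 : Real.log x ≤ x - 1 := Real.log_le_sub_one_of_pos hx0
    linarith

end Wilson

end Summit.Ventures.LatticeQCDFlow.Theory2.Lattice.TwoDim

end
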